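import Mathlib.RingTheory.Ideal.Quotient.Operations
import Literature.Algebra.EuclideanDomain.TransfiniteSmallestAlgorithm
import HarnessLib

/-!
# The quotient Euclidean function: an algorithm descends to every homomorphic image, and
# `θ(b) = sup_{x̄ ∈ R/(b)} (min_{x ∈ x̄} θ(x) + 1)` (Clark 2015, Thm. 19, Cor. 20)

Topic `Literature/Algebra/EuclideanDomain`, namespaces `Literature.Algebra.EuclideanDomain.Algorithm` (§1, arbitrary
algorithms, as in `NormalisedEuclideanAlgorithm.lean`) and `Literature.Algebra.EuclideanDomain` (§2, the smallest algorithm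
`samuelRank = θ` of `TransfiniteSmallestAlgorithm.lean`).  THEOREMS ONLY (no `def`, no instance, no named fact), all proved.
An *algorithm* is Samuel's Definition 1, `φ : A → W`, `W` well ordered, with (E) «for `a, b ∈ A`, `b ≠ 0`, there are `q, r`
with `a = bq + r` and `φ(r) < φ(b)`» (hypothesis `hφ`; Motzkin's form `r = 0 ∨ φ r < φ b` in the primed statements).  The
tree had Cor. 20 for the smallest algorithm only (`IntProdIntSmallestAlgorithm.lean` §1: stages map into stages,
`samuelRank_map_le_of_surjective`, `iSup_samuelRank_map_le_of_surjective`); here Thm. 19 (a) is proved for an ARBITRARY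
algorithm and Thm. 19 (b) — the characteristic property of the bottom function — for `θ`.

## Source (read at the page)

P. L. Clark, *A note on Euclidean order types*, Order **32** (2015) 157–178 [Clark2015EuclideanOrderTypes] (materialised
`paper:arxiv-1208.0977`, arXiv numbering; `p0006.txt`), §2.7 «The Quotient Euclidean Function», VERBATIM.  **Theorem 19.**
«Let `φ : R → Ord` be a Euclidean function.  Let `b ∈ R•` …, and let `f : R → R/(b)` be the quotient map.  For `x ∈ R/(b)`, let
`x̃ ∈ f⁻¹(x)` be any element such that `φ(x̃) ≤ φ(y)` for all `y ∈ f⁻¹(x)`.  a) Then `φ′ : x ∈ (R/(b))• ↦ φ(x̃)` is a Euclidean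
function.  b) For the bottom Euclidean function `φ_R`, we have `φ′_R(0) = sup_{x̄ ≠ 0̄} φ′_R(x̄) + 1 = φ_R(b)`.  Proof. a) For
`x ∈ R/(b)`, `y ∈ (R/(b))•`, `x̃ ∈ R`, `ỹ ∈ R•`, so there are `q, r ∈ R` with `x̃ = qỹ + r` and `φ(r) < φ(ỹ)`.  Then
`x = f(q)y + f(r)` and hence `φ′(f(r)) ≤ φ(r) < φ(ỹ) = φ′(y)`.  b) … The second equality is a key – in fact, characteristic –
property of the bottom Euclidean function which is proved in [Samuel71].»  **Corollary 20.** «If `R` is Euclidean, so is every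
quotient ring `R′`, and `e(R′) ≤ e(R)`.»  (Samuel 1971 §4, Prop. 10 / the transfinite construction (p. 289): «`A_α` is the
union of `{0}` and the set of all `b ∈ A` such that the canonical map `A_α′ → A/Ab` is surjective».)

## What is formalised

* §1 **Thm. 19 (a) for an arbitrary algorithm and an arbitrary SURJECTIVE ring homomorphism** `f : R → S` (the quotient map
  being the case `S = R/(b)`): there is an algorithm `φ′` on `S` with `φ′(f x) ≤ φ(x)` for all `x` and `φ′(s) = φ(x̃)` for a
  minimising lift `x̃` of `s` (`Algorithm.exists_algorithm_of_surjective`; Motzkin's form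
  `Algorithm.exists_euclideanFunction_of_surjective`); Cor. 20 for arbitrary value sets: a quotient of a ring with a
  `W`-valued (resp. `ℕ`-valued) algorithm has one (`Algorithm.exists_algorithm_quotient`, `…_nat_quotient`).
* §2 **Thm. 19 (b)**, the characteristic property of the smallest algorithm `θ` of a ring exhausted by its transfinite
  construction: for `b ≠ 0`, `θ(b) = ⨆_{a ∈ R} (min {θ(r) | r ≡ a (mod b)} + 1)` (`samuelRank_eq_iSup_sInf_add_one`), the same
  indexed by the classes `x̄ ∈ R/(b)` (`samuelRank_eq_iSup_quotient`), each term being `> ` the minimum over the class and the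
  bottom function of `R/(b)` lying below these minima (`samuelRank_mk_le_sInf`).

## Mathlib / tree search

Mathlib: `WellFounded.min` / `min_mem` / `not_lt_min`, `csInf_mem` / `csInf_le'` (ordinals), `Ordinal.iSup_le` / `Ordinal.le_iSup`,
`Order.add_one_le_of_lt`, `Ideal.Quotient.eq`, `Ideal.mem_span_singleton`.  Tree: `TransfiniteSmallestAlgorithm.lean`
(`mem_samuelSet_samuelRank`, `forall_of_mem_samuelSet`, `mem_samuelSet_of_forall`, `samuelRank_le_of_mem`),
`IntProdIntSmallestAlgorithm.lean` §1 (`samuelRank_map_le_of_surjective` — the `θ`-only form of Cor. 20, not restated).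
-/

universe u

/-! ## §1 Thm. 19 (a): an algorithm descends along every surjective ring homomorphism -/

namespace Literature.Algebra.EuclideanDomain.Algorithm

section Descent

variable {R : Type*} [CommRing R] {S : Type*} [CommRing S] {F : Type*} [FunLike F R S] [RingHomClass F R S]
  {W : Type*} [LinearOrder W] [WellFoundedLT W] {φ : R → W}

/-- **Thm. 19 (a)** «`φ′ : x ↦ φ(x̃)`, `x̃` a lift of `x` of least value, is a Euclidean function» on the image of a surjective
ring homomorphism `f` (for the quotient map: on `R/(b)`): `x̃ = qỹ + r`, `φ(r) < φ(ỹ)` gives `x = f(q)y + f(r)` with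
`φ′(f r) ≤ φ(r) < φ(ỹ) = φ′(y)`.  Stated as the existence of `φ′` with its two defining properties.
[cite: Clark2015EuclideanOrderTypes, Thm. 19 (a)] -/
theorem exists_algorithm_of_surjective (hφ : ∀ a b : R, b ≠ 0 → ∃ q r : R, a = b * q + r ∧ φ r < φ b) (f : F)
    (hf : Function.Surjective f) :
    ∃ φ' : S → W, (∀ a b : S, b ≠ 0 → ∃ q r : S, a = b * q + r ∧ φ' r < φ' b) ∧
      (∀ x : R, φ' (f x) ≤ φ x) ∧ (∀ s : S, ∃ x : R, f x = s ∧ φ' s = φ x) := by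
  have hne : ∀ s : S, (φ '' (f ⁻¹' {s})).Nonempty := fun s ↦ by
    obtain ⟨x, rfl⟩ := hf s
    exact ⟨φ x, x, rfl, rfl⟩
  let φ' : S → W := fun s ↦ WellFounded.min wellFounded_lt (φ '' (f ⁻¹' {s})) (hne s)
  have hmem : ∀ s, φ' s ∈ φ '' (f ⁻¹' {s}) := fun s ↦ WellFounded.min_mem _ _ _
  have hmin : ∀ (s : S) (x : R), f x = s → φ' s ≤ φ x := fun s x hx ↦
    not_lt.1 (WellFounded.not_lt_min wellFounded_lt (φ '' (f ⁻¹' {s})) ⟨x, hx, rfl⟩)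
  refine ⟨φ', fun a b hb ↦ ?_, fun x ↦ hmin _ x rfl, fun s ↦ ?_⟩
  · obtain ⟨y, hy, hφy⟩ := hmem b
    have hfy : f y = b := hy
    obtain ⟨x, rfl⟩ := hf a
    have hy0 : y ≠ 0 := fun h0 ↦ hb (by rw [← hfy, h0, map_zero])
    obtain ⟨q, r, hqr, hr⟩ := hφ x y hy0
    refine ⟨f q, f r, by rw [hqr, map_add, map_mul, hfy], ?_⟩
    calc φ' (f r) ≤ φ r := hmin _ r rfl
      _ < φ y := hr
      _ = φ' b := hφy
  · obtain ⟨x, hx, hφx⟩ := hmem s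
    exact ⟨x, hx, hφx.symm⟩

/-- Thm. 19 (a) in Motzkin's form (`a = bq + r` with `r = 0` or `φ r < φ b`). [cite: Clark2015EuclideanOrderTypes, Thm. 19 (a)] -/
theorem exists_euclideanFunction_of_surjective
    (hφ : ∀ a b : R, b ≠ 0 → ∃ q r : R, a = b * q + r ∧ (r = 0 ∨ φ r < φ b)) (f : F) (hf : Function.Surjective f) :
    ∃ φ' : S → W, (∀ a b : S, b ≠ 0 → ∃ q r : S, a = b * q + r ∧ (r = 0 ∨ φ' r < φ' b)) ∧
      (∀ x : R, φ' (f x) ≤ φ x) ∧ (∀ s : S, ∃ x : R, f x = s ∧ φ' s = φ x) := by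
  have hne : ∀ s : S, (φ '' (f ⁻¹' {s})).Nonempty := fun s ↦ by
    obtain ⟨x, rfl⟩ := hf s
    exact ⟨φ x, x, rfl, rfl⟩
  let φ' : S → W := fun s ↦ WellFounded.min wellFounded_lt (φ '' (f ⁻¹' {s})) (hne s)
  have hmem : ∀ s, φ' s ∈ φ '' (f ⁻¹' {s}) := fun s ↦ WellFounded.min_mem _ _ _
  have hmin : ∀ (s : S) (x : R), f x = s → φ' s ≤ φ x := fun s x hx ↦
    not_lt.1 (WellFounded.not_lt_min wellFounded_lt (φ '' (f ⁻¹' {s})) ⟨x, hx, rfl⟩)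
  refine ⟨φ', fun a b hb ↦ ?_, fun x ↦ hmin _ x rfl, fun s ↦ ?_⟩
  · obtain ⟨y, hy, hφy⟩ := hmem b
    have hfy : f y = b := hy
    obtain ⟨x, rfl⟩ := hf a
    have hy0 : y ≠ 0 := fun h0 ↦ hb (by rw [← hfy, h0, map_zero])
    obtain ⟨q, r, hqr, hr⟩ := hφ x y hy0
    refine ⟨f q, f r, by rw [hqr, map_add, map_mul, hfy], ?_⟩
    rcases hr with rfl | hr
    · exact Or.inl (map_zero f)
    · exact Or.inr (calc φ' (f r) ≤ φ r := hmin _ r rfl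
        _ < φ y := hr
        _ = φ' b := hφy)
  · obtain ⟨x, hx, hφx⟩ := hmem s
    exact ⟨x, hx, hφx.symm⟩

end Descent

section Quotient

variable {R : Type*} [CommRing R] {W : Type*} [LinearOrder W] [WellFoundedLT W] {φ : R → W}

/-- **Cor. 20 «If `R` is Euclidean, so is every quotient ring `R′`»** for algorithms with values in any well-ordered `W`:
`R/I` carries a `W`-valued algorithm dominated by `φ` along the quotient map. [cite: Clark2015EuclideanOrderTypes, Cor. 20] -/
theorem exists_algorithm_quotient (hφ : ∀ a b : R, b ≠ 0 → ∃ q r : R, a = b * q + r ∧ φ r < φ b) (I : Ideal R) :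
    ∃ φ' : R ⧸ I → W, (∀ a b : R ⧸ I, b ≠ 0 → ∃ q r : R ⧸ I, a = b * q + r ∧ φ' r < φ' b) ∧
      ∀ x : R, φ' (Ideal.Quotient.mk I x) ≤ φ x := by
  obtain ⟨φ', h1, h2, -⟩ := exists_algorithm_of_surjective hφ (Ideal.Quotient.mk I) Ideal.Quotient.mk_surjective
  exact ⟨φ', h1, h2⟩

/-- Cor. 20 for ordinary `ℕ`-valued Euclidean functions (Motzkin's form): a quotient of an `ℕ`-Euclidean ring is
`ℕ`-Euclidean. [cite: Clark2015EuclideanOrderTypes, Cor. 20] -/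
theorem exists_euclideanFunction_nat_quotient {φ : R → ℕ}
    (hφ : ∀ a b : R, b ≠ 0 → ∃ q r : R, a = b * q + r ∧ (r = 0 ∨ φ r < φ b)) (I : Ideal R) :
    ∃ φ' : R ⧸ I → ℕ, (∀ a b : R ⧸ I, b ≠ 0 → ∃ q r : R ⧸ I, a = b * q + r ∧ (r = 0 ∨ φ' r < φ' b)) ∧
      ∀ x : R, φ' (Ideal.Quotient.mk I x) ≤ φ x := by
  obtain ⟨φ', h1, h2, -⟩ :=
    exists_euclideanFunction_of_surjective hφ (Ideal.Quotient.mk I) Ideal.Quotient.mk_surjective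
  exact ⟨φ', h1, h2⟩

end Quotient

end Literature.Algebra.EuclideanDomain.Algorithm

/-! ## §2 Thm. 19 (b): the characteristic property of the smallest algorithm -/

namespace Literature.Algebra.EuclideanDomain

open Ordinal

variable {R : Type u} [CommRing R]

/-- **Thm. 19 (b)** «`φ′_R(0̄) = sup_{x̄} φ′_R(x̄) + 1 = φ_R(b)`» — the «key – in fact, characteristic – property of the bottom
Euclidean function» (Samuel's Prop. 10 ∕ the definition of the transfinite construction: `b ∈ A_α` iff every class mod `b`
meets `⋃_{β<α} A_β`): for `b ≠ 0` in a ring exhausted by its transfinite construction,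
`θ(b) = ⨆_a (min {θ(r) : r ≡ a (mod b)} + 1)`. [cite: Clark2015EuclideanOrderTypes, Thm. 19 (b); Samuel1971, Prop. 10 (p. 288)] -/
theorem samuelRank_eq_iSup_sInf_add_one (h : ∀ z : R, ∃ α : Ordinal.{u}, z ∈ samuelSet R α) {b : R} (hb : b ≠ 0) :
    samuelRank b = ⨆ a : R, (sInf (samuelRank '' {r : R | b ∣ a - r}) + 1) := by
  have hne : ∀ a : R, (samuelRank '' {r : R | b ∣ a - r}).Nonempty := fun a ↦ ⟨_, a, by simp, rfl⟩
  refine le_antisymm ?_ (Ordinal.iSup_le fun a ↦ ?_)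
  · -- `b ∈ A_α` for `α` the right-hand side: the class of `a` is met by a minimiser `r ∈ A_{θ r}`, `θ r < θ r + 1 ≤ α`
    refine samuelRank_le_of_mem (mem_samuelSet_of_forall fun a ↦ ?_)
    obtain ⟨r, hr, hθr⟩ := csInf_mem (hne a)
    refine ⟨samuelRank r, ?_, r, mem_samuelSet_samuelRank (h r), hr⟩
    calc samuelRank r = sInf (samuelRank '' {r : R | b ∣ a - r}) := hθr
      _ < sInf (samuelRank '' {r : R | b ∣ a - r}) + 1 := lt_add_one _
      _ ≤ ⨆ a : R, (sInf (samuelRank '' {r : R | b ∣ a - r}) + 1) :=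
          Ordinal.le_iSup (fun a : R ↦ sInf (samuelRank '' {r : R | b ∣ a - r}) + 1) a
  · -- each class is met before stage `θ(b)`
    obtain ⟨β, hβ, r, hr, hdvd⟩ := forall_of_mem_samuelSet (mem_samuelSet_samuelRank (h b)) hb a
    have hmem : samuelRank r ∈ samuelRank '' {r : R | b ∣ a - r} := ⟨r, hdvd, rfl⟩
    have hle : sInf (samuelRank '' {r : R | b ∣ a - r}) ≤ β := (csInf_le' hmem).trans (samuelRank_le_of_mem hr)
    exact Order.add_one_le_of_lt (hle.trans_lt hβ)

/-- Thm. 19 (b) indexed, as printed, by the classes `x̄ ∈ R/(b)`: `θ(b) = ⨆_{x̄} (min_{x ∈ x̄} θ(x) + 1)`.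
[cite: Clark2015EuclideanOrderTypes, Thm. 19 (b)] -/
theorem samuelRank_eq_iSup_quotient (h : ∀ z : R, ∃ α : Ordinal.{u}, z ∈ samuelSet R α) {b : R} (hb : b ≠ 0) :
    samuelRank b = ⨆ s : R ⧸ Ideal.span ({b} : Set R),
      (sInf (samuelRank '' (Ideal.Quotient.mk (Ideal.span ({b} : Set R)) ⁻¹' {s})) + 1) := by
  -- the fibre of the class of `a` is `{r | b ∣ a - r}`
  have hfib : ∀ a : R, Ideal.Quotient.mk (Ideal.span ({b} : Set R)) ⁻¹' {Ideal.Quotient.mk (Ideal.span {b}) a} =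
      {r : R | b ∣ a - r} := fun a ↦ by
    ext r
    simp only [Set.mem_preimage, Set.mem_singleton_iff, Set.mem_setOf_eq, Ideal.Quotient.eq, Ideal.mem_span_singleton]
    exact dvd_sub_comm
  rw [samuelRank_eq_iSup_sInf_add_one h hb]
  refine le_antisymm (Ordinal.iSup_le fun a ↦ ?_) (Ordinal.iSup_le fun s ↦ ?_)
  · rw [← hfib a]
    exact Ordinal.le_iSup (fun s : R ⧸ Ideal.span ({b} : Set R) ↦
      sInf (samuelRank '' (Ideal.Quotient.mk (Ideal.span ({b} : Set R)) ⁻¹' {s})) + 1) _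
  · obtain ⟨a, rfl⟩ := Ideal.Quotient.mk_surjective s
    rw [hfib a]
    exact Ordinal.le_iSup (fun a : R ↦ sInf (samuelRank '' {r : R | b ∣ a - r}) + 1) a

/-- Each term is dominated: `min_{x ∈ x̄} θ(x) < θ(b)` for every class `x̄` mod `b ≠ 0` («`φ′_R(x̄) < φ′_R(0̄) = φ_R(b)`»).
[cite: Clark2015EuclideanOrderTypes, Thm. 19 (b)] -/
theorem sInf_samuelRank_lt (h : ∀ z : R, ∃ α : Ordinal.{u}, z ∈ samuelSet R α) {b : R} (hb : b ≠ 0) (a : R) :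
    sInf (samuelRank '' {r : R | b ∣ a - r}) < samuelRank b := by
  obtain ⟨β, hβ, r, hr, hdvd⟩ := forall_of_mem_samuelSet (mem_samuelSet_samuelRank (h b)) hb a
  have hmem : samuelRank r ∈ samuelRank '' {r : R | b ∣ a - r} := ⟨r, hdvd, rfl⟩
  exact ((csInf_le' hmem).trans (samuelRank_le_of_mem hr)).trans_lt hβ

/-- The bottom function of the quotient lies below Clark's `φ′_R`: `θ_{R/(b)}(x̄) ≤ min_{x ∈ x̄} θ_R(x)` (stages map into
stages). [cite: Clark2015EuclideanOrderTypes, Thm. 19 and Cor. 20] -/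
theorem samuelRank_mk_le_sInf (h : ∀ z : R, ∃ α : Ordinal.{u}, z ∈ samuelSet R α) (I : Ideal R) (a : R) :
    samuelRank (Ideal.Quotient.mk I a) ≤ sInf (samuelRank '' (Ideal.Quotient.mk I ⁻¹' {Ideal.Quotient.mk I a})) := by
  have hne : (samuelRank '' (Ideal.Quotient.mk I ⁻¹' {Ideal.Quotient.mk I a})).Nonempty := ⟨_, a, rfl, rfl⟩
  obtain ⟨r, hr, hθr⟩ := csInf_mem hne
  have hra : Ideal.Quotient.mk I r = Ideal.Quotient.mk I a := hr
  rw [← hθr, ← hra]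
  -- stages map into stages along the quotient map (transfinite induction, as in `IntProdIntSmallestAlgorithm.lean` §1)
  refine samuelRank_le_of_mem ?_
  have key : ∀ (α : Ordinal.{u}) {x : R}, x ∈ samuelSet R α → Ideal.Quotient.mk I x ∈ samuelSet (R ⧸ I) α := by
    intro α
    induction α using WellFoundedLT.induction with
    | ind α ih =>
      intro x hx
      rcases mem_samuelSet_iff.1 hx with rfl | H
      · rw [map_zero]
        exact zero_mem_samuelSet α
      · refine mem_samuelSet_of_forall fun y' ↦ ?_
        obtain ⟨y, rfl⟩ := Ideal.Quotient.mk_surjective y'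
        obtain ⟨β, hβ, s, hs, hd⟩ := H y
        exact ⟨β, hβ, Ideal.Quotient.mk I s, ih β hβ hs, by rw [← map_sub]; exact map_dvd _ hd⟩
  exact key _ (mem_samuelSet_samuelRank (h r))

end Literature.Algebra.EuclideanDomain
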